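import Summits.NavierStokesRegularity.NavierStokesRegularity.Theses.HubbleDynamo
import Summits.NavierStokesRegularity.NavierStokesRegularity.Theorems.HubbleDynamoNoSelfExcitedDynamoReduction
import Summits.NavierStokesRegularity.NavierStokesRegularity.Theorems.HubbleDynamoNoSelfExcitedDynamoStubPastShift
import Summits.NavierStokesRegularity.NavierStokesRegularity.Theorems.HubbleDynamoNoSelfExcitedDynamoStubForwardVanishing
import Summits.NavierStokesRegularity.NavierStokesRegularity.Theorems.HubbleDynamoNoSelfExcitedDynamoStubSingleTimeSwitchOff
import Summits.NavierStokesRegularity.NavierStokesRegularity.Theorems.HubbleDynamoNoSelfExcitedDynamoStubAlphaLimit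
import Summits.NavierStokesRegularity.NavierStokesRegularity.Theorems.HubbleDynamoNoSelfExcitedDynamoStubLimitClosed
import Summits.NavierStokesRegularity.NavierStokesRegularity.Theorems.HubbleDynamoNoSelfExcitedDynamoStubRecurrentProfile
import Summits.NavierStokesRegularity.NavierStokesRegularity.Theorems.HubbleDynamoNoSelfExcitedDynamoStubUniformlyRecurrentProfile
import Summits.NavierStokesRegularity.NavierStokesRegularity.Theorems.HubbleDynamoNoSelfExcitedDynamoStubEnstrophyBalance
import Summits.NavierStokesRegularity.NavierStokesRegularity.Theorems.HubbleDynamoNoSelfExcitedDynamoStubDivCurlProfile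
import Summits.NavierStokesRegularity.NavierStokesRegularity.Theorems.HubbleDynamoNoSelfExcitedDynamoStubStretchSobolev
import Summits.NavierStokesRegularity.NavierStokesRegularity.Theorems.HubbleDynamoNoSelfExcitedDynamoStubEnstrophyEvolution
import Summits.NavierStokesRegularity.NavierStokesRegularity.Theorems.HubbleDynamoNoSelfExcitedDynamoStubEnstrophyBootstrapODE
import Summits.NavierStokesRegularity.NavierStokesRegularity.Theorems.HubbleDynamoNoSelfExcitedDynamoStubRecurrentVanishingOfEnstrophyDecay
import Summits.NavierStokesRegularity.NavierStokesRegularity.Theorems.HubbleDynamoNoSelfExcitedDynamoEnstrophyFloorSharp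
import Summits.NavierStokesRegularity.NavierStokesRegularity.Theorems.HubbleDynamoNoSelfExcitedDynamoStubFarFieldTransfer
import Summits.NavierStokesRegularity.NavierStokesRegularity.Theorems.HubbleDynamoNoSelfExcitedDynamoStubStrainRegime
import Summits.NavierStokesRegularity.NavierStokesRegularity.Theorems.HubbleDynamoNoSelfExcitedDynamoStubBeltramiRegime
import Literature.Analysis.FluidPDE.SobolevWholeSpace
import HarnessLib.Audit

/-!
# Line `registered` — skeleton v20 (lead c4; v16 of lead c3 reshaped three times: v17/v18 F1+S1, v19/v20 B1)
# of the crux `HubbleDynamo.NoSelfExcitedDynamo`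

(crux item `stmt-NavierStokesRegularity-1934`, route `route-NavierStokesRegularity-HubbleDynamo`; lead
`prover-line-stmt-NavierStokesRegularity-1934-c4-0` (gen 1, continuation c4), 2026-08-17; tree path
`Cruxes/NoSelfExcitedDynamo/Lines/birth.lean`.)

THE CRUX. `NoSelfExcitedDynamo`: every bounded ancient mild solution `u` of Navier–Stokes (`ν = 1`,
duality form) on `ℝ³ × (−∞, 0)` with measurable slices and the pointwise Type-I bound
`‖u(t, x)‖ ≤ C / (‖x‖ + √(−t))` has a.e.-zero slices (KNSS Liouville conjecture, pointwise Type-I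
class; open in print).

LANDED before this seat (namespace `…Theorems.NoSelfExcitedDynamo.Registered`, all `--supports stmt-…-1934`;
34 files of leads c0–c3, see `Lines/birth.md`): reduction to / from the ETERNAL Liouville problem for
Leray's backward system `∂ₛU + ½U + ½(y·∇)U + (U·∇)U + ∇P = ΔU`, `div U = 0` on `ℝ × ℝ³` in the
uniform profile class `(1 + ‖y‖)^{k+1}‖DᵏU‖ ≤ K_k`; Backus regime (p150871); switch-off, α-limits,
compactness, Birkhoff recurrence made UNIFORM (p156442, p156604, p157292, p157655, p160274);
crux ⇔ (G) ⇔ (G′) ⇔ (G″) ⇔ G‴ ⇔ G⁗ (p156662, p156885, p157861, p160780, p166299, p166766); rungs: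
small-period DSS (p157634), axisymmetric (p157667); node ⇒ crux (p156252, p157812); enstrophy
identity `½E′ = S − D_F − ¼E` (p149756, p165354) with div–curl (p164427), Sobolev stretching bound
(p165103), bootstrap (p165682), recurrent vanishing (p165776): the ENSTROPHY FLOOR `K_S⁶E² ≥ 64/27`.

THIS SEAT (lead c4) — three new levers, each a PROVABLE regime split off the open stub and LANDED,
plus the physical-variables rung and the bridges:
* F1 `stub_farFieldTransfer` (LANDED p172846; Albritton–Barker 2019 Thm 4.1, ε = 0, a tree THEOREM
  `AlbrittonBarker2019_liouville_weakL3_backward_holds`): an eternal profile-class solution ONE of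
  whose slices has trivial blow-down at spatial infinity (`λW(s₀)(λ·) ⇀ 0`) vanishes. Physical form
  LANDED p173288 (`farFieldRung`, `farFieldRung_of_finiteEnergySlice`): the crux HOLDS for every `u`
  with one blow-down-trivial slice, in particular ONE FINITE-ENERGY SLICE (Leray–Hopf class).
* S1 `stub_strainRegime` (LANDED p172986; vorticity maximum principle in similarity variables,
  `D⁻ max|Ω|² ≤ 2(μ − 1) max|Ω|²`): `⟪v, DW v⟫ ≤ μ‖v‖²` with `μ < 1` everywhere ⇒ `W ≡ 0`
  (threshold `¼` from the enstrophy identity alone: `strainRegime_quarter`).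
* B1 `stub_beltramiRegime` (LANDED p173916; `S = ∫⟪W × Ω, curl Ω⟫` — only the non-Beltrami part of
  `curl Ω` stretches): `‖W‖ ≤ K`, `D_⊥ ≤ βD`, `βK² < 1` ⇒ `W ≡ 0`; `β = 1` is Backus.
* Bridges LANDED p173343 (G⁵ ⇔ crux, node ⇒ G⁵) and (v20) G⁶ ⇔ crux, node ⇒ G⁶.
ONE open stub: G⁶ `stub_noRecurrentProfileAboveFloorWithTailNonBeltrami` ≡ crux (the open problem),
now carrying the portrait: uniformly recurrent, enstrophy floor, NONTRIVIAL `−1`-HOMOGENEOUS TAIL at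
every time (infinite energy, no `Lᵖ` slice `p ≤ 3`; the tail at radius `r` is the mid-field of the
remote past `s − 2 log r`), `sup λ_max(sym DW) ≥ 1` (so `K₁ ≥ 1`, vorticity max in the core),
`sup‖W‖² · sup D_⊥/D ≥ 1` (not nearly force-free), plus the inherited amplitude floor, `sup‖W‖ ≥ 1`,
not axisymmetric, not small-period DSS.
`NoSelfExcitedDynamo_of : NoSelfExcitedDynamo` is the ONLY crux-concluding declaration (by name).
-/

noncomputable section

open Set MeasureTheory Filter Topology InnerProductSpace Function
open scoped ContDiff RealInnerProductSpace NNReal ENNReal Laplacian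
open Literature.Analysis.FluidPDE
open Summit.NavierStokesRegularity.NavierStokesRegularity.Theorems.NoSelfExcitedDynamo.Registered

namespace Summit.NavierStokesRegularity.NavierStokesRegularity.Cruxes.NoSelfExcitedDynamo.Birth

set_option linter.unusedVariables false
set_option linter.dupNamespace false

/-! ### Stubs T1, T2, T3, T6, T5: LANDED (p164427, p165103, p165354, p165682, p165776) and imported -/

/-! ### RESHAPE v17/v18 (lead c4): G⁗ ⇐ F1 `stub_farFieldTransfer` (LANDED p172846) + S1 `stub_strainRegime` (LANDED p172986) + G⁵ (open) -/

/-! ### RESHAPE v19/v20 (lead c4): G⁵ ⇐ B1 `stub_beltramiRegime` (LANDED p173916) + G⁶ (open) -/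

/-- **stub G⁶ — `stub_noRecurrentProfileAboveFloorWithTailNonBeltrami`** (XL; OPEN — the load-bearing
stub, v19 residue of G⁵). A UNIFORMLY RECURRENT eternal classical solution `(W, Q)` of Leray's
backward system (`a = ½`, `ν = 1`) on `ℝ × ℝ³` in the uniform profile class which (i) stays above
the absolute enstrophy floor `K_S⁶(∫‖curl W(s)‖²)² ≥ 64/27` at every `s`, (ii) has a NONTRIVIAL
BLOW-DOWN TAIL at spatial infinity at every time, (iii) has rate-of-strain reaching the self-similar
vorticity rate (`sup ⟪v, DW v⟫/‖v‖² ≥ 1`), and (iv) is NOT NEARLY FORCE-FREE relative to its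
amplitude — for every `β ≥ 0`, `K` with `βK² < 1` and `‖W‖ ≤ K`, at some time the non-Beltrami part
of `curl Ω` carries more than the fraction `β` of `∫|curl Ω|²` — vanishes identically (no such
solution exists). Given B1 (and F1, S1, the floor) this is EQUIVALENT to G⁵, hence to the crux; it is
implied by the node crux `RecurrentLiouville` (stmt-1589). -/
theorem stub_noRecurrentProfileAboveFloorWithTailNonBeltrami :
    ∀ (W : ℝ → EuclideanSpace ℝ (Fin 3) → EuclideanSpace ℝ (Fin 3)) (Q : ℝ → EuclideanSpace ℝ (Fin 3) → ℝ),
      IsBackwardLeraySolutionOn univ 1 W Q →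
      (∀ k : ℕ, ∃ K : ℝ, ∀ s y, (1 + ‖y‖) ^ (k + 1) * ‖iteratedFDeriv ℝ k (W s) y‖ ≤ K) →
      (∀ ε : ℝ, 0 < ε → ∀ R : ℝ, ∃ L : ℝ, 0 < L ∧ ∀ a : ℝ, ∃ σ ∈ Icc a (a + L),
        ∀ s ∈ Icc (-R) R, ∀ y ∈ Metric.closedBall (0 : EuclideanSpace ℝ (Fin 3)) R,
          ‖W (s + σ) y - W s y‖ < ε) →
      (∀ s, 64 / 27 ≤ ((SNormLESNormFDerivOfEqConst (EuclideanSpace ℝ (Fin 3))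
            (volume : Measure (EuclideanSpace ℝ (Fin 3))) 2 : ℝ≥0) : ℝ) ^ 6 *
          (∫ y, ‖curl (W s) y‖ ^ 2) ^ 2) →
      (∀ s₀ : ℝ, ∃ φ : EuclideanSpace ℝ (Fin 3) → EuclideanSpace ℝ (Fin 3),
        Literature.Analysis.FunctionSpaces.IsTestFunctionOn
            (⊤ : TopologicalSpace.Opens (EuclideanSpace ℝ (Fin 3))) φ ∧
          ¬ Tendsto (fun lam : ℝ => ∫ y, ⟪lam • W s₀ (lam • y), φ y⟫) atTop (𝓝 0)) →
      (∀ μ : ℝ, μ < 1 → ∃ s y, ∃ v : EuclideanSpace ℝ (Fin 3), μ * ‖v‖ ^ 2 < ⟪v, fderiv ℝ (W s) y v⟫) →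
      (∀ β K : ℝ, 0 ≤ β → β * K ^ 2 < 1 → (∀ s y, ‖W s y‖ ≤ K) →
        ∃ s, β * ∫ y, ‖curl (curl (W s)) y‖ ^ 2 <
          ∫ y, (‖curl (curl (W s)) y‖ ^ 2 -
            ⟪curl (curl (W s)) y, curl (W s) y⟫ ^ 2 / ‖curl (W s) y‖ ^ 2)) →
      ∀ s y, W s y = 0 := by
  sorry

/-- **G⁵ from B1 and G⁶** (CLOSED composition, v19): either some `β ≥ 0`, `K` with `βK² < 1`,
`‖W‖ ≤ K` and `D_⊥ ≤ βD` at all times exist (B1 kills the solution), or clause (iv) of G⁶ holds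
(G⁶ kills it). This is the registered open stub of v17/v18; its statement is unchanged. -/
theorem stub_noRecurrentProfileAboveFloorWithTail :
    ∀ (W : ℝ → EuclideanSpace ℝ (Fin 3) → EuclideanSpace ℝ (Fin 3)) (Q : ℝ → EuclideanSpace ℝ (Fin 3) → ℝ),
      IsBackwardLeraySolutionOn univ 1 W Q →
      (∀ k : ℕ, ∃ K : ℝ, ∀ s y, (1 + ‖y‖) ^ (k + 1) * ‖iteratedFDeriv ℝ k (W s) y‖ ≤ K) →
      (∀ ε : ℝ, 0 < ε → ∀ R : ℝ, ∃ L : ℝ, 0 < L ∧ ∀ a : ℝ, ∃ σ ∈ Icc a (a + L),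
        ∀ s ∈ Icc (-R) R, ∀ y ∈ Metric.closedBall (0 : EuclideanSpace ℝ (Fin 3)) R,
          ‖W (s + σ) y - W s y‖ < ε) →
      (∀ s, 64 / 27 ≤ ((SNormLESNormFDerivOfEqConst (EuclideanSpace ℝ (Fin 3))
            (volume : Measure (EuclideanSpace ℝ (Fin 3))) 2 : ℝ≥0) : ℝ) ^ 6 *
          (∫ y, ‖curl (W s) y‖ ^ 2) ^ 2) →
      (∀ s₀ : ℝ, ∃ φ : EuclideanSpace ℝ (Fin 3) → EuclideanSpace ℝ (Fin 3),
        Literature.Analysis.FunctionSpaces.IsTestFunctionOn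
            (⊤ : TopologicalSpace.Opens (EuclideanSpace ℝ (Fin 3))) φ ∧
          ¬ Tendsto (fun lam : ℝ => ∫ y, ⟪lam • W s₀ (lam • y), φ y⟫) atTop (𝓝 0)) →
      (∀ μ : ℝ, μ < 1 → ∃ s y, ∃ v : EuclideanSpace ℝ (Fin 3), μ * ‖v‖ ^ 2 < ⟪v, fderiv ℝ (W s) y v⟫) →
      ∀ s y, W s y = 0 := by
  intro W Q hW hprof hrec hfloor htail hstrain
  by_cases hbel : ∃ β K : ℝ, 0 ≤ β ∧ β * K ^ 2 < 1 ∧ (∀ s y, ‖W s y‖ ≤ K) ∧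
      ∀ s, ∫ y, (‖curl (curl (W s)) y‖ ^ 2 -
          ⟪curl (curl (W s)) y, curl (W s) y⟫ ^ 2 / ‖curl (W s) y‖ ^ 2) ≤
        β * ∫ y, ‖curl (curl (W s)) y‖ ^ 2
  · exact stub_beltramiRegime W Q hW hprof hbel
  push Not at hbel
  exact stub_noRecurrentProfileAboveFloorWithTailNonBeltrami W Q hW hprof hrec hfloor htail hstrain
    (fun β K hβ hβK hK => hbel β K hβ hβK hK)

/-- **G⁗ from F1, S1 and G⁵** (CLOSED composition, v17): a uniformly recurrent eternal
profile-class solution above the sharp enstrophy floor either has a slice with trivial blow-down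
(F1 kills it), or a uniform strain bound `μ < 1` (S1 kills it), or satisfies (ii) and (iii) of G⁵
(G⁵ kills it). This was the registered open stub of v16 (lead c3); its statement is unchanged. -/
theorem stub_noRecurrentProfileAboveSharpEnstrophyFloor :
    ∀ (W : ℝ → EuclideanSpace ℝ (Fin 3) → EuclideanSpace ℝ (Fin 3)) (Q : ℝ → EuclideanSpace ℝ (Fin 3) → ℝ),
      IsBackwardLeraySolutionOn univ 1 W Q →
      (∀ k : ℕ, ∃ K : ℝ, ∀ s y, (1 + ‖y‖) ^ (k + 1) * ‖iteratedFDeriv ℝ k (W s) y‖ ≤ K) →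
      (∀ ε : ℝ, 0 < ε → ∀ R : ℝ, ∃ L : ℝ, 0 < L ∧ ∀ a : ℝ, ∃ σ ∈ Icc a (a + L),
        ∀ s ∈ Icc (-R) R, ∀ y ∈ Metric.closedBall (0 : EuclideanSpace ℝ (Fin 3)) R,
          ‖W (s + σ) y - W s y‖ < ε) →
      (∀ s, 64 / 27 ≤ ((SNormLESNormFDerivOfEqConst (EuclideanSpace ℝ (Fin 3))
            (volume : Measure (EuclideanSpace ℝ (Fin 3))) 2 : ℝ≥0) : ℝ) ^ 6 *
          (∫ y, ‖curl (W s) y‖ ^ 2) ^ 2) →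
      ∀ s y, W s y = 0 := by
  intro W Q hW hprof hrec hfloor
  by_cases htail : ∃ s₀ : ℝ, ∀ φ : EuclideanSpace ℝ (Fin 3) → EuclideanSpace ℝ (Fin 3),
      Literature.Analysis.FunctionSpaces.IsTestFunctionOn
          (⊤ : TopologicalSpace.Opens (EuclideanSpace ℝ (Fin 3))) φ →
        Tendsto (fun lam : ℝ => ∫ y, ⟪lam • W s₀ (lam • y), φ y⟫) atTop (𝓝 0)
  · exact stub_farFieldTransfer W Q hW hprof htail
  by_cases hstrain : ∃ μ : ℝ, μ < 1 ∧
      ∀ s y (v : EuclideanSpace ℝ (Fin 3)), ⟪v, fderiv ℝ (W s) y v⟫ ≤ μ * ‖v‖ ^ 2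
  · exact stub_strainRegime W Q hW hprof hstrain
  push Not at htail hstrain
  refine stub_noRecurrentProfileAboveFloorWithTail W Q hW hprof hrec hfloor (fun s₀ => ?_) (fun μ hμ => ?_)
  · obtain ⟨φ, hφ, hnot⟩ := htail s₀
    exact ⟨φ, hφ, hnot⟩
  · obtain ⟨s, y, v, hv⟩ := hstrain μ hμ
    exact ⟨s, y, v, hv⟩

/-! ### Closed composition: G″ from G⁗ (the sharp enstrophy floor, landed) -/

/-- **G″ from G⁗ and the sharp enstrophy floor** (CLOSED; everything it uses is landed: T1 p164427,
T2 p165103, T3 p165354, T6 p165682, T5 p165776, floor p166299, sharp floor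
`noUniformlyRecurrentTypeIProfile_of_noRecurrentProfileAboveSharpFloor`): a uniformly recurrent
eternal profile-class solution is either below the floor at some time (`enstrophyFloorSharp` kills it)
or above it at every time (G⁗ kills it). -/
theorem noUniformlyRecurrentTypeIProfile_of_floor
    (hG4 : ∀ (W : ℝ → EuclideanSpace ℝ (Fin 3) → EuclideanSpace ℝ (Fin 3)) (Q : ℝ → EuclideanSpace ℝ (Fin 3) → ℝ),
      IsBackwardLeraySolutionOn univ 1 W Q →
      (∀ k : ℕ, ∃ K : ℝ, ∀ s y, (1 + ‖y‖) ^ (k + 1) * ‖iteratedFDeriv ℝ k (W s) y‖ ≤ K) →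
      (∀ ε : ℝ, 0 < ε → ∀ R : ℝ, ∃ L : ℝ, 0 < L ∧ ∀ a : ℝ, ∃ σ ∈ Icc a (a + L),
        ∀ s ∈ Icc (-R) R, ∀ y ∈ Metric.closedBall (0 : EuclideanSpace ℝ (Fin 3)) R,
          ‖W (s + σ) y - W s y‖ < ε) →
      (∀ s, 64 / 27 ≤ ((SNormLESNormFDerivOfEqConst (EuclideanSpace ℝ (Fin 3))
            (volume : Measure (EuclideanSpace ℝ (Fin 3))) 2 : ℝ≥0) : ℝ) ^ 6 *
          (∫ y, ‖curl (W s) y‖ ^ 2) ^ 2) →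
      ∀ s y, W s y = 0) :
    ∀ (W : ℝ → EuclideanSpace ℝ (Fin 3) → EuclideanSpace ℝ (Fin 3)) (Q : ℝ → EuclideanSpace ℝ (Fin 3) → ℝ),
      IsBackwardLeraySolutionOn univ 1 W Q →
      (∀ k : ℕ, ∃ K : ℝ, ∀ s y, (1 + ‖y‖) ^ (k + 1) * ‖iteratedFDeriv ℝ k (W s) y‖ ≤ K) →
      (∀ ε : ℝ, 0 < ε → ∀ R : ℝ, ∃ L : ℝ, 0 < L ∧ ∀ a : ℝ, ∃ σ ∈ Icc a (a + L),
        ∀ s ∈ Icc (-R) R, ∀ y ∈ Metric.closedBall (0 : EuclideanSpace ℝ (Fin 3)) R,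
          ‖W (s + σ) y - W s y‖ < ε) →
      ∀ s y, W s y = 0 :=
  noUniformlyRecurrentTypeIProfile_of_noRecurrentProfileAboveSharpFloor hG4

/-! ### The composition (closed; as in v13): no uniformly recurrent Type-I profile ⇒ eternal Liouville ⇒ crux -/

/-- **Eternal Liouville from stubs E, H3 (landed) and G″** (CLOSED): an eternal profile-class solution
vanishes. If its amplitude is `δ`-small at arbitrarily early times for every `δ > 0`,
`stub_pastSmallnessLiouville` (p156442) applies; otherwise some `δ > 0` is an amplitude floor on a
past half-line, stub H3 (`stub_uniformlyRecurrentProfile`, p160274) realises it at every time by a UNIFORMLY RECURRENT eternal profile-class `W`,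
and stub G″ makes `W ≡ 0` — contradicting the floor. -/
theorem eternalLiouville_of_noUniformlyRecurrentTypeIProfile
    (hG : ∀ (W : ℝ → EuclideanSpace ℝ (Fin 3) → EuclideanSpace ℝ (Fin 3)) (Q : ℝ → EuclideanSpace ℝ (Fin 3) → ℝ),
      IsBackwardLeraySolutionOn univ 1 W Q →
      (∀ k : ℕ, ∃ K : ℝ, ∀ s y, (1 + ‖y‖) ^ (k + 1) * ‖iteratedFDeriv ℝ k (W s) y‖ ≤ K) →
      (∀ ε : ℝ, 0 < ε → ∀ R : ℝ, ∃ L : ℝ, 0 < L ∧ ∀ a : ℝ, ∃ σ ∈ Icc a (a + L),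
        ∀ s ∈ Icc (-R) R, ∀ y ∈ Metric.closedBall (0 : EuclideanSpace ℝ (Fin 3)) R,
          ‖W (s + σ) y - W s y‖ < ε) →
      ∀ s y, W s y = 0)
    (U : ℝ → EuclideanSpace ℝ (Fin 3) → EuclideanSpace ℝ (Fin 3)) (P : ℝ → EuclideanSpace ℝ (Fin 3) → ℝ)
    (hL : IsBackwardLeraySolutionOn univ 1 U P)
    (hprof : ∀ k : ℕ, ∃ K : ℝ, ∀ s y, (1 + ‖y‖) ^ (k + 1) * ‖iteratedFDeriv ℝ k (U s) y‖ ≤ K) :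
    ∀ s y, U s y = 0 := by
  refine stub_pastSmallnessLiouville U P hL hprof fun δ hδ S => ?_
  by_contra hcon
  push Not at hcon
  obtain ⟨W, Q, hW, hWprof, hfloor, hrec⟩ :=
    stub_uniformlyRecurrentProfile U P hL hprof δ S hδ fun s hs => (hcon s hs).imp fun y hy => hy.le
  obtain ⟨y, hy⟩ := hfloor 0
  have h0 : W 0 y = 0 := hG W Q hW hWprof hrec 0 y
  rw [h0, norm_zero] at hy
  exact absurd hy (not_le.2 hδ)

/-- **Composition, hypotheses form** (CLOSED; H3 landed): no uniformly recurrent Type-I profile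
(G″) implies the crux (written UNFOLDED, definitionally the body of
`NoSelfExcitedDynamo`), through the landed eternal Liouville reduction `stub_eternalReduction` and
`eternalLiouville_of_noUniformlyRecurrentTypeIProfile`. -/
theorem compose
    (hG : ∀ (W : ℝ → EuclideanSpace ℝ (Fin 3) → EuclideanSpace ℝ (Fin 3)) (Q : ℝ → EuclideanSpace ℝ (Fin 3) → ℝ),
      IsBackwardLeraySolutionOn univ 1 W Q →
      (∀ k : ℕ, ∃ K : ℝ, ∀ s y, (1 + ‖y‖) ^ (k + 1) * ‖iteratedFDeriv ℝ k (W s) y‖ ≤ K) →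
      (∀ ε : ℝ, 0 < ε → ∀ R : ℝ, ∃ L : ℝ, 0 < L ∧ ∀ a : ℝ, ∃ σ ∈ Icc a (a + L),
        ∀ s ∈ Icc (-R) R, ∀ y ∈ Metric.closedBall (0 : EuclideanSpace ℝ (Fin 3)) R,
          ‖W (s + σ) y - W s y‖ < ε) →
      ∀ s y, W s y = 0) :
    ∀ u : ℝ → EuclideanSpace ℝ (Fin 3) → EuclideanSpace ℝ (Fin 3),
      IsBoundedAncientMildSolution 1 u →
      (∀ t < 0, AEStronglyMeasurable (u t) volume) → (∃ C : ℝ, HasTypeIDecay C u) →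
      ∀ t < 0, u t =ᵐ[volume] (0 : EuclideanSpace ℝ (Fin 3) → EuclideanSpace ℝ (Fin 3)) :=
  stub_eternalReduction fun U P hL hprof _ => eternalLiouville_of_noUniformlyRecurrentTypeIProfile hG U P hL hprof

/-! ### The skeleton: the crux BY NAME, modulo the registered stubs -/

/-- **The line skeleton** (A12 by-name form): `NoSelfExcitedDynamo` from the open stub G⁗ (no
uniformly recurrent Type-I profile above the sharp enstrophy floor; the stubs T1, T2, T3, T6, T5 and
the floor are landed), through `noUniformlyRecurrentTypeIProfile_of_floor` and the closed `compose`. This is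
the ONLY declaration of the file concluding the crux; it inherits the stubs' placeholders (and
nothing else). -/
theorem NoSelfExcitedDynamo_of : Theses.HubbleDynamo.NoSelfExcitedDynamo :=
  compose (noUniformlyRecurrentTypeIProfile_of_floor stub_noRecurrentProfileAboveSharpEnstrophyFloor)

end Summit.NavierStokesRegularity.NavierStokesRegularity.Cruxes.NoSelfExcitedDynamo.Birth
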